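import Mathlib.Algebra.Polynomial.FieldDivision
import Mathlib.RingTheory.Polynomial.ScaleRoots
import Mathlib.RingTheory.Ideal.Quotient.Operations
import Mathlib.RingTheory.PrincipalIdealDomain
import Mathlib.RingTheory.UniqueFactorizationDomain.NormalizedFactors
import Mathlib.Algebra.GCDMonoid.Basic
import HarnessLib

/-!
# A unit `F` of `E[X]/(χ)` with `F(X) ≡ λ F(QX) (mod χ)`

Topic `Algebra/Polynomial`; namespace `Literature.Algebra.Polynomial`. Let `E` be a field,
`Q ∈ E` non-zero and **not a root of unity**, `χ ∈ E[X]` with `χ(0) ≠ 0`, and `λ ∈ Eˣ`. Then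
(`exists_isCoprime_dvd_sub_C_mul_comp`) **there is a polynomial `F`, coprime to `χ`, with
`χ ∣ F(X) - λ F(QX)`**. This is the polynomial identity behind the *weight trick* for
`q`-commutation relations: if `ψ` is an invertible operator on a finite-dimensional space with
`N ψ = Q ψ N`, then `A = F(ψ)` (`χ` = the minimal or characteristic polynomial of `ψ`) is
invertible, lies in the bicommutant of `ψ`, and satisfies `A N = λ N A` — so the pairs `(ψ, N)`
and `(ψ, λ N)` are conjugate by an element commuting with everything that commutes with `ψ`. It
is used in `Literature/NumberTheory/GaloisRepresentations/WeilDeligneOfGaloisProofs.lean` to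
prove that a Weil–Deligne representation `(ρ, N)` is isomorphic to `(ρ, λ N)` (independence of
the choice of the `ℓ`-adic tame character in Grothendieck's construction; Deligne, Antwerp II
(1973), §8.4.2).

## Proof

Let `P` be the (finite) set of monic irreducible factors of `χ` (`normalizedFactors`). Dilation
`p(X) ↦ p(QX)` corresponds, on monic polynomials, to Mathlib's `scaleRoots · Q⁻¹` (the roots are
divided by `Q`): `(scaleRoots p s)(s X) = s^{deg p} p(X)` (`scaleRoots_comp_C_mul_X`). Since `Q` is
not a root of unity and `X ∤ χ`, iterating the dilation never returns to a factor of `χ`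
(`coeff_zero_eq_zero_of_scaleRoots_eq`, `exists_scaleRoots_notMem`), so the **weight**
`w(s) = min {j | scaleRoots s (Q⁻¹)^{j+1} ∉ P}` is defined and satisfies
`w(scaleRoots p Q) = w(p) + 1` for `p ∈ P`. By the Chinese remainder theorem
(`Ideal.exists_forall_sub_mem_ideal`) choose `F ≡ λ^{-w(s)} (mod s^M)` for every `s` in the finite
set `S = P ∪ scaleRoots(P, Q)` of pairwise coprime monic irreducibles, `M` larger than all
multiplicities. For `p ∈ P`, substituting `X ↦ QX` in the congruence at `scaleRoots p Q` gives
`F(QX) ≡ λ^{-w(p)-1} (mod p^M)`, whence `p^M ∣ F - λ F(QX)`; and `p ∤ F` since `F ≡ unit (mod p)`.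

## Mathlib

`Polynomial.scaleRoots` (`scaleRoots_mul`, `scaleRoots_one`, `scaleRoots_eval₂_mul`,
`mul_scaleRoots_of_noZeroDivisors`, `degree_scaleRoots`, `monic_scaleRoots_iff`),
`Polynomial.mem_normalizedFactors_iff`, `Polynomial.leadingCoeff_mul_prod_normalizedFactors`,
`Ideal.exists_forall_sub_mem_ideal`, `Finset.prod_dvd_of_coprime`,
`Irreducible.coprime_iff_not_dvd`, `Nat.find_comp_succ`. Mathlib has no such statement (searched
`scaleRoots`, `comp (C _ * X)`, `q-difference`).

## References

Folklore; the application is P. Deligne, *Les constantes des équations fonctionnelles des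
fonctions `L`*, Antwerp II, LNM 349 (1973), §8.4.2 (independence of `t_ℓ`).
-/

open Polynomial UniqueFactorizationMonoid

namespace Literature.Algebra.Polynomial

variable {E : Type*} [Field E]

/-- Scaling the roots by a non-zero constant preserves irreducibility (the inverse scaling
transports factorisations, and units are the non-zero constants). [folklore] -/
theorem irreducible_scaleRoots {p : E[X]} (hp : Irreducible p) {s : E} (hs : s ≠ 0) :
    Irreducible (scaleRoots p s) := by
  refine irreducible_iff.mpr ⟨fun hu => hp.not_isUnit ?_, fun a b hab => ?_⟩
  · rw [isUnit_iff_degree_eq_zero] at hu ⊢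
    rwa [degree_scaleRoots] at hu
  · have h : p = scaleRoots a s⁻¹ * scaleRoots b s⁻¹ := by
      rw [← mul_scaleRoots_of_noZeroDivisors, ← hab, ← scaleRoots_mul, mul_inv_cancel₀ hs,
        scaleRoots_one]
    rcases hp.isUnit_or_isUnit h with ha | hb
    · left
      rw [isUnit_iff_degree_eq_zero] at ha ⊢
      rwa [degree_scaleRoots] at ha
    · right
      rw [isUnit_iff_degree_eq_zero] at hb ⊢
      rwa [degree_scaleRoots] at hb

/-- `(scaleRoots p s)(s X) = s ^ deg p · p(X)`: dilating the variable undoes the scaling of the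
roots up to the unit `s ^ deg p` (Mathlib `scaleRoots_eval₂_mul` with `f = C`, `r = X`).
[folklore] -/
theorem scaleRoots_comp_C_mul_X (p : E[X]) (s : E) :
    (scaleRoots p s).comp (C s * X) = C (s ^ p.natDegree) * p := by
  have h := scaleRoots_eval₂_mul (p := p) (C : E →+* E[X]) X s
  change (scaleRoots p s).eval₂ C (C s * X) = _
  rw [h, C_pow, eval₂_C_X]

/-- No cycles under dilation: if `scaleRoots r c = r` with `c ^ e ≠ 1` for all `e ≥ 1` and
`deg r ≥ 1`, then `r(0) = 0` (comparing constant coefficients: `r₀ c^{deg r} = r₀`). [folklore] -/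
theorem coeff_zero_eq_zero_of_scaleRoots_eq {r : E[X]} {c : E} (hc : ∀ e : ℕ, 0 < e → c ^ e ≠ 1)
    (h : scaleRoots r c = r) (hr : 0 < r.natDegree) : r.coeff 0 = 0 := by
  have h0 := congrArg (fun q : E[X] => q.coeff 0) h
  simp only [coeff_scaleRoots, Nat.sub_zero] at h0
  by_contra hne
  apply hc r.natDegree hr
  have : r.coeff 0 * (c ^ r.natDegree - 1) = 0 := by rw [mul_sub, mul_one, h0, sub_self]
  rcases mul_eq_zero.mp this with h1 | h1
  · exact absurd h1 hne
  · exact sub_eq_zero.mp h1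

variable [DecidableEq E]

/-- For `Q` not a root of unity and `χ(0) ≠ 0`, the iterated dilations
`scaleRoots s (Q⁻¹)^{j+1}` of any polynomial `s` eventually leave the finite set of monic
irreducible factors of `χ` (otherwise two of them coincide by pigeonhole, giving a factor `r` of
`χ` fixed by a non-trivial dilation, whence `r(0) = 0` and `χ(0) = 0`). [folklore] -/
theorem exists_scaleRoots_notMem {Q : E} (hQ : ∀ e : ℕ, 0 < e → Q ^ e ≠ 1)
    {χ : E[X]} (hχ : χ.coeff 0 ≠ 0) (s : E[X]) :
    ∃ j : ℕ, scaleRoots s (Q⁻¹ ^ (j + 1)) ∉ (normalizedFactors χ).toFinset := by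
  have hχ0 : χ ≠ 0 := fun h => hχ (by rw [h, coeff_zero])
  by_contra hall
  push Not at hall
  set P := (normalizedFactors χ).toFinset with hP
  let g : ℕ → P := fun j => ⟨scaleRoots s (Q⁻¹ ^ (j + 1)), hall j⟩
  obtain ⟨a, b, hab, hgab⟩ := Finite.exists_ne_map_eq_of_infinite g
  -- wlog a < b
  wlog hlt : a < b generalizing a b
  · exact this b a hab.symm hgab.symm (lt_of_le_of_ne (not_lt.mp hlt) hab.symm)
  have hg : scaleRoots s (Q⁻¹ ^ (a + 1)) = scaleRoots s (Q⁻¹ ^ (b + 1)) :=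
    congrArg Subtype.val hgab
  set r := scaleRoots s (Q⁻¹ ^ (a + 1)) with hr
  have hrP : r ∈ normalizedFactors χ := Multiset.mem_toFinset.mp (hall a)
  rw [Polynomial.mem_normalizedFactors_iff hχ0] at hrP
  obtain ⟨hirr, -, hdvd⟩ := hrP
  -- `scaleRoots r (Q⁻¹ ^ (b - a)) = r`
  have hcyc : scaleRoots r (Q⁻¹ ^ (b - a)) = r := by
    rw [hr, ← scaleRoots_mul, ← pow_add, show a + 1 + (b - a) = b + 1 by omega, ← hg]
  have hdeg : 0 < r.natDegree := by
    rcases Nat.eq_zero_or_pos r.natDegree with hd0 | hpos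
    · exact absurd (by rw [isUnit_iff_degree_eq_zero, degree_eq_natDegree hirr.ne_zero, hd0]; rfl)
        hirr.not_isUnit
    · exact hpos
  have hc : ∀ e : ℕ, 0 < e → (Q⁻¹ ^ (b - a)) ^ e ≠ 1 := by
    intro e he h1
    rw [← pow_mul, inv_pow, inv_eq_one] at h1
    exact hQ _ (Nat.mul_pos (by omega) he) h1
  have h0 := coeff_zero_eq_zero_of_scaleRoots_eq hc hcyc hdeg
  -- `r ∣ χ` and `r.coeff 0 = 0` contradict `χ.coeff 0 ≠ 0`
  obtain ⟨t, ht⟩ := hdvd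
  apply hχ
  rw [ht, mul_coeff_zero, h0, zero_mul]

/-- **A unit `F` modulo `χ` with `F(X) ≡ λ F(QX)`.** For `Q ≠ 0` not a root of unity,
`χ ∈ E[X]` with `χ(0) ≠ 0` and `λ ≠ 0`, there is `F ∈ E[X]` coprime to `χ` with
`χ ∣ F - λ · F(QX)` (`F(QX) = F.comp (C Q * X)`). Proof: Chinese remainder theorem with residues
`λ^{-w(s)}` along the dilation chains of the irreducible factors of `χ` (module docstring).
[folklore] -/
theorem exists_isCoprime_dvd_sub_C_mul_comp {Q : E} (hQ0 : Q ≠ 0)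
    (hQ : ∀ e : ℕ, 0 < e → Q ^ e ≠ 1) {χ : E[X]} (hχ : χ.coeff 0 ≠ 0) {l : E} (hl : l ≠ 0) :
    ∃ F : E[X], IsCoprime F χ ∧ χ ∣ F - C l * F.comp (C Q * X) := by
  have hχ0 : χ ≠ 0 := fun h => hχ (by rw [h, coeff_zero])
  set P := (normalizedFactors χ).toFinset with hP
  have hPmem : ∀ p ∈ P, Irreducible p ∧ p.Monic ∧ p ∣ χ := fun p hp =>
    (Polynomial.mem_normalizedFactors_iff hχ0).mp (Multiset.mem_toFinset.mp hp)
  -- the weight of a polynomial and its behaviour under `scaleRoots · Q`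
  let w : E[X] → ℕ := fun s => Nat.find (exists_scaleRoots_notMem hQ hχ s)
  have hw : ∀ p ∈ P, w (scaleRoots p Q) = w p + 1 := by
    intro p hp
    have hkey : ∀ n : ℕ, scaleRoots (scaleRoots p Q) (Q⁻¹ ^ (n + 1)) =
        scaleRoots p (Q⁻¹ ^ n) := by
      intro n
      rw [← scaleRoots_mul, pow_succ', ← mul_assoc, mul_inv_cancel₀ hQ0, one_mul]
    have h₂ : ∃ n : ℕ, scaleRoots (scaleRoots p Q) (Q⁻¹ ^ (n + 1 + 1)) ∉ P := by
      obtain ⟨n, hn⟩ := exists_scaleRoots_notMem hQ hχ p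
      exact ⟨n, by rwa [hkey]⟩
    have h0 : ¬ (scaleRoots (scaleRoots p Q) (Q⁻¹ ^ (0 + 1)) ∉ P) := by
      rw [hkey, pow_zero, scaleRoots_one, not_not]
      exact hp
    change Nat.find _ = Nat.find _ + 1
    rw [Nat.find_comp_succ _ h₂ h0]
    congr 1
    apply Nat.find_congr'
    intro n
    rw [hkey]
  -- the residues
  let c : E[X] → E := fun s => l⁻¹ ^ w s
  have hc0 : ∀ s, c s ≠ 0 := fun s => pow_ne_zero _ (inv_ne_zero hl)
  have hc : ∀ p ∈ P, c p = l * c (scaleRoots p Q) := by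
    intro p hp
    simp only [c, hw p hp, pow_succ]
    field_simp
  -- the moduli: `P` together with its image under `scaleRoots · Q`
  set S := P ∪ P.image (fun p => scaleRoots p Q) with hS
  have hSmem : ∀ s ∈ S, Irreducible s ∧ s.Monic := by
    intro s hs
    rcases Finset.mem_union.mp hs with h | h
    · exact ⟨(hPmem s h).1, (hPmem s h).2.1⟩
    · obtain ⟨p, hp, rfl⟩ := Finset.mem_image.mp h
      exact ⟨irreducible_scaleRoots (hPmem p hp).1 hQ0,
        (monic_scaleRoots_iff Q).mpr (hPmem p hp).2.1⟩
  have hScop : ∀ s ∈ S, ∀ s' ∈ S, s ≠ s' → IsCoprime s s' := by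
    intro s hs s' hs' hne
    refine ((hSmem s hs).1.coprime_iff_not_dvd).mpr fun hd => hne ?_
    exact eq_of_monic_of_associated (hSmem s hs).2 (hSmem s' hs').2
      ((hSmem s hs).1.associated_of_dvd (hSmem s' hs').1 hd)
  -- Chinese remainder theorem
  set M := (normalizedFactors χ).card + 1 with hM
  have hcopI : Pairwise (Function.onFun IsCoprime fun s : S => Ideal.span {(s : E[X]) ^ M}) := by
    intro s s' hne
    simp only [Function.onFun]
    rw [Ideal.isCoprime_span_singleton_iff]
    exact (hScop s s.2 s' s'.2 (fun h => hne (Subtype.ext h))).pow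
  obtain ⟨F, hF⟩ := Ideal.exists_forall_sub_mem_ideal hcopI (fun s => C (c s))
  have hFdvd : ∀ s ∈ S, s ^ M ∣ F - C (c s) := fun s hs =>
    Ideal.mem_span_singleton.mp (hF ⟨s, hs⟩)
  -- `p ^ M ∣ F - l F(Q X)` for every `p ∈ P`
  have hpdvd : ∀ p ∈ P, p ^ M ∣ F - C l * F.comp (C Q * X) := by
    intro p hp
    have h1 : p ^ M ∣ F - C (c p) := hFdvd p (Finset.mem_union_left _ hp)
    have h2 : (scaleRoots p Q) ^ M ∣ F - C (c (scaleRoots p Q)) :=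
      hFdvd _ (Finset.mem_union_right _ (Finset.mem_image_of_mem _ hp))
    have h3 : p ^ M ∣ F.comp (C Q * X) - C (c (scaleRoots p Q)) := by
      have h := map_dvd (compRingHom (C Q * X)) h2
      simp only [coe_compRingHom, map_pow, map_sub] at h
      rw [scaleRoots_comp_C_mul_X, C_comp, mul_pow] at h
      exact (Dvd.intro_left _ rfl).trans h
    have h4 : F - C l * F.comp (C Q * X) =
        (F - C (c p)) - C l * (F.comp (C Q * X) - C (c (scaleRoots p Q))) := by
      rw [hc p hp, C_mul]
      ring
    rw [h4]
    exact dvd_sub h1 (dvd_mul_of_dvd_right h3 _)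
  -- `χ = lead χ · ∏_{p ∈ P} p ^ count p`
  have hχeq : χ = C χ.leadingCoeff * ∏ p ∈ P, p ^ (normalizedFactors χ).count p := by
    rw [← Finset.prod_multiset_count, leadingCoeff_mul_prod_normalizedFactors]
  have hlead : IsUnit (C χ.leadingCoeff) :=
    isUnit_C.mpr (IsUnit.mk0 _ (leadingCoeff_ne_zero.mpr hχ0))
  have hPcop : (P : Set E[X]).Pairwise
      (Function.onFun IsCoprime fun p => p ^ (normalizedFactors χ).count p) :=
    fun p hp p' hp' hne => (hScop p (Finset.mem_union_left _ hp) p'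
      (Finset.mem_union_left _ hp') hne).pow
  refine ⟨F, ?_, ?_⟩
  · -- coprimality
    rw [hχeq, isCoprime_mul_unit_left_right hlead]
    refine IsCoprime.prod_right fun p hp => IsCoprime.pow_right ?_
    refine (((hPmem p hp).1.coprime_iff_not_dvd).mpr fun hpF => ?_).symm
    have h1 : p ∣ F - C (c p) :=
      (dvd_pow_self p (by omega)).trans (hFdvd p (Finset.mem_union_left _ hp))
    have h2 : p ∣ C (c p) := by
      have := dvd_sub hpF h1
      rwa [sub_sub_cancel] at this
    exact (hPmem p hp).1.not_isUnit
      (isUnit_of_dvd_unit h2 (isUnit_C.mpr (IsUnit.mk0 _ (hc0 p))))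
  · -- divisibility
    rw [hχeq, IsUnit.mul_left_dvd hlead]
    refine Finset.prod_dvd_of_coprime hPcop fun p hp => ?_
    exact (pow_dvd_pow p (by
      have := Multiset.count_le_card p (normalizedFactors χ); omega)).trans (hpdvd p hp)

end Literature.Algebra.Polynomial
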